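import Summits.QuantumFields.BalabanUV.Beta.FP.GhostLoopCountingMix
import Summits.QuantumFields.BalabanUV.Beta.FP.MixLoopPowerCountingMassCubic

/-!
# `Beta/FP/GhostLoopCountingMixCubic` — road «FP» (binder row D1), organisation γ, row **(GH-a) COUNTING, piece (g4)** «the four scalar constraint loops in MIX
# mass currency»: THE (MIX-3) ENGINE `MixLoopPowerCountingMassCubic.coarse_mix3_secondMoment_le` AT THE 0-FORM ROOTED BLOCK FAMILY AND THE SCALAR MINIMISER's
# COLUMNS — sibling of `FP/GhostLoopCountingMix` ((MIX-2)) and `FP/GhostLoopCountingMixQuartic` ((MIX-4)); the cubic loop's OTHER legs (`Γ = Gh` the constrained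
# scalar propagator, `Ḣ = Δ̇_B` the covariant Laplacian's jet) stay ABSTRACT with the engine's letters DISPLAYED ([folklore] index plumbing on `ℤ⁴`; no road object)

HONEST FRAMING (cell `pub-balaban`, β sub-cell, verbatim): discharging `BetaPertH` makes Bałaban's UV stability UNCONDITIONAL — a real constructive-QFT
result; it is NOT the continuum limit and NOT the Clay problem.  THIS MODULE is [folklore] finite-sum plumbing (a far field-leg offset contributes a vanishing jet
entry) composed BY NAME with ACCEPTED tree theorems: `MixLoopPowerCountingMassCubic.coarse_mix3_secondMoment_le` (t4-ne7b-formalise-leaf-01-g23, RHOA-6c′ (MIX-3)),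
this lineage's `ScalarAveragingJetLetters` (0-form family) and `GhostLoopCountingMix` (`scl_ker₁_fld_local`, `windowedMass_scl_le`, `ghostColumn_engineLetters`).  It
asserts nothing about Bałaban's objects, cites nothing, mints no `Prop` fact, has no `def`, 0 sorry.  The letters of `Γ` ((Γ₀) sup `C_Γ`, (Γ₁) first differences
`C_Γ′(‖c−t‖+1)⁻³e^{−(δ∕N)‖c−t‖}`) and of `Ḣ` ((H) `C_He^{−δ_H(|x−b′|₁+|x′−b′|₁)}`, (H0) zero mass) are HYPOTHESES exactly as the engine displays them — their ghost
instances (IR-4's `Gh = G₀ − E` letters; the ultra-local jet of `Δ_B`) are the LEDGER's, NOT pinned here.  NOT the identification of `T₃^{gh}` with the K_n-ghost's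
(MIX-3) term `tr(ΓḢ𝓘Q̇′)` (KER-γ (α)), NOT the instance number (KER-γ (γ)), NOT (MIX-1) (waits on the gluon (INST-MIX1)'s free-window rewrite, to be cited BY NAME),
NOT (GH-a) as a whole, NOT `Mix_n = O(1)`, NOT hbook, NOT D1, NOT BetaPertH, NOT continuum, NOT Clay.
HONEST DEPENDENCY: continuum YM on T⁴ ⇐ BetaPertH ∧ nine spine estimates (0/9 proved); BetaPertH ⇐ (D1) ∧ (D4) ∧ CAP+tail; G-an2-4 gates asym, D1 and NE2/3/4.

ABSOLUTE RULE (cell charter, verbatim): «No internally-minted statement may enter as a cited fact. Every hypothesis is either kernel-proved in this package or a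
verbatim quotation of a PUBLISHED theorem with page reference. The manuscript(s) under audit are NOT citable for their own disputed steps — they are the thing under
adjudication; programme-internal (2001/route/tribunal) claims are never citable.»

THE ROW (road-FP OWNER b2b-balaban-beta-d1-p3, `LEAVES-FP.md` row (GH-a) COUNTING (R-FP-28 (d)), piece (g4)).  BINDING CHECK (R-FP-28 (d), displayed): the cubic loop
carries ONE lattice difference — on the `Γ` leg, through the zero-mass letter (H0) of `Ḣ` (summation by parts inside the engine's `abs_cubicT_le`); no difference on
the jet or the columns.  CURRENCY: as in `GhostLoopCountingMix` (point labels; free radial rules with the length letter `ℓ₀` and the ℕ-valued radius letter; free `p σ ≥ 0`,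
free `a > 0`); the field-leg offset window `W` is FREE (far offsets vanish, `legSum_eq_filter`), the coarse windows `U b` are FREE ((M) holds for any `U`).

CONTENT.  §1 `legSum_eq_filter` (far offsets vanish in the jet-leg sum), **`coarse_mix3_secondMoment_scl`** (the engine at `qd := ker₁ (sclW N p) (sclFld N u) (sclBg N u rad)`,
(M) := `windowedMass_scl_le` at the centre `N•v₀`, radius multiplier `R₀+1` after filtering `W`; legs `I` (sup), `J` ((J)(J′)), `Γ`, `Ḣ` ABSTRACT under the engine's
letters); §2 THE END **`ghost_mix3_rem`**: with `C, C′` of `ghostColumn_engineLetters`, for every `a > 0`, `N ≥ 1`, every 0-form rooted family, every `Γ`, `Ḣ` with the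
displayed letters at rates `δ := deltaH 4 1`, `δ_H > 0`, all finite `W`, `S`, `V`, any `U`, every `v₀`:
`Σ_{v∈V}‖v−v₀‖∞²·|Σ_{b,b′∈S} 𝓘_gh(b,v₀)·𝓘_gh(b′,v)·Σ_{u∈U b}Σ_{w∈W} ker₁^{(u)} b (b+w)·Σ'_{x′} 𝓘_gh(x′,u)·Σ'_x Γ (b+w) x·Ḣ b′ x x′|`
`≤ 3·C·C′·(1+16∕δ²)·((C·(C_H·Zl 4 δ_H))·Ψ(C_Γ, C_Γ′, δ, δ_H, R₀+1, N)·((ℓ₀·Σp)·e^{δR₀∕2}·(e^{δ∕2}(1+480e^{δ∕4}(4∕δ)⁴))))` with the engine's `Ψ = K₁(C_Γ′,δ_H)·Θ₁(δ,R₀+1)·N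
+ K₂(C_Γ,δ_H)·81·(3+2(R₀+1)²)` VERBATIM — EVERY power of `N` displayed: `N¹·(ℓ₀·Σp)` × numbers × the `Γ`∕`Ḣ` letter constants (the cubic leg's zeroth fine moment carries
the `N`; in the road's units `C_Γ′ ≍ N⁻³`-type letters absorb it — the LEDGER's bookkeeping, exactly as the engine's header says for the gluon).
Provenance: D1 formalisation swarm, unit `b2b-balaban-beta-d1-formalise-leaf-05` gen 14 (prover-…-leaf-05-g14-0), 2026-08-21, first refusal on (GH-a) (g4) exercised (journal
INTENT 2026-08-21T03:56:26Z); «not in print; our bookkeeping»; no existing file touched.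
-/

noncomputable section

namespace Summit.QuantumFields.BalabanUV.Beta.FP.GhostLoopCountingMixCubic

open Finset Real
open scoped BigOperators
open Literature.MathematicalPhysics.QuantumFieldTheory.Balaban1983to89
open Literature.MathematicalPhysics.QuantumFieldTheory.Balaban1983to89.Beta
open B12Sec2to5 (l1)
open ExpKernelCalculus (Zl)
open DyadicShell (Pt supNorm)
open AxialBlockWeights (fineBlock)
open B5Hk103ScalarZd (kerH deltaH deltaH_pos)
open Summit.QuantumFields.BalabanUV.Beta.FP.AveragingJetLettersRooted (ker₁)
open Summit.QuantumFields.BalabanUV.Beta.FP.ScalarAveragingJetLetters (sclW sclFld sclBg)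
open Summit.QuantumFields.BalabanUV.Beta.FP.MixLoopPowerCountingMassCubic (coarse_mix3_secondMoment_le)
open Summit.QuantumFields.BalabanUV.Beta.FP.GhostLoopCountingMix (scl_ker₁_fld_local windowedMass_scl_le ghostColumn_engineLetters)

/-! ## §1 Free offset window and the (MIX-3) engine at the 0-form family, abstract legs -/

/-- [folklore] **FAR OFFSETS VANISH IN THE JET-LEG SUM**: if `q u b (b + w) = 0` unless `PW w`, then `Σ_{w∈W} q u b (b+w)·F(b+w) = Σ_{w∈W.filter PW} q u b (b+w)·F(b+w)`. -/
theorem legSum_eq_filter {q : Pt → Pt → Pt → ℝ} (F : Pt → ℝ) (PW : Pt → Prop) [DecidablePred PW]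
    (hzW : ∀ u b w, ¬ PW w → q u b (b + w) = 0) (W : Finset Pt) (u b : Pt) :
    ∑ w ∈ W, q u b (b + w) * F (b + w) = ∑ w ∈ W.filter PW, q u b (b + w) * F (b + w) := by
  rw [Finset.sum_filter_of_ne]
  intro w _ hne
  by_contra hfar
  exact hne (by rw [hzW u b w hfar, zero_mul])

section Scalar

variable {σ : Type*} [Fintype σ] {N : ℕ} {p : σ → ℝ} {rad : σ → Pt → Pt → List Pt} {ℓ₀ R₀ : ℕ}

/-- **THE (MIX-3) ENGINE AT THE 0-FORM FAMILY, ABSTRACT LEGS, FREE OFFSET WINDOW** ([folklore] plumbing; `coarse_mix3_secondMoment_le` BY NAME with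
`qd u b c := ker₁ (sclW N p) (sclFld N u) (sclBg N u rad) b c` on the FILTERED offset window `‖w‖∞ ≤ (R₀+1)N` (far offsets vanish, `scl_ker₁_fld_local`), radius multiplier
`R := R₀+1`, (M) := `windowedMass_scl_le` at the centre `N•v₀`): under the engine's leg letters (I₀) `|I x′ u| ≤ C_I`, (Γ₀) `|Γ c x| ≤ C_Γ`, (Γ₁) `|Γ c (t+e_i) − Γ c t| ≤
C_Γ′(‖c−t‖∞+1)⁻³e^{−(δ∕N)‖c−t‖∞}`, (H) `|Ḣ b′ x x′| ≤ C_He^{−δ_H|x−b′|₁}e^{−δ_H|x′−b′|₁}`, (H0) `Σ'_x Ḣ b′ x x′ = 0`, (J), (J′), for ANY `U`, all finite `W`, `S`, `V`, every `v₀`: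
`Σ_{v∈V}‖v−v₀‖∞²·|Σ_{b,b′∈S} J b v₀·J b′ v·Σ_{u∈U b}Σ_{w∈W} ker₁^{(u)} b (b+w)·Σ'_{x′} I x′ u·Σ'_x Γ (b+w) x·Ḣ b′ x x′| ≤ 3·C_J·C_J′·(1+16∕δ²)·(L·Ψ·A_M)` with the engine's
`L = C_I·(C_H·Zl 4 δ_H)`, `Ψ` (explicit `N`) at `R = R₀+1`, `A_M = (ℓ₀·Σp)·e^{δR₀∕2}·(e^{δ∕2}(1+480e^{δ∕4}(4∕δ)⁴))`. -/
theorem coarse_mix3_secondMoment_scl {δ δH : ℝ} (hδ : 0 < δ) (hδH : 0 < δH) (hN : 1 ≤ N) (hp : ∀ s, 0 ≤ p s)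
    (hrad : ∀ s u x', (rad s u x').length ≤ ℓ₀)
    (hradR : ∀ (s : σ) (u : Pt) (x : ↥(fineBlock N)) (ℓ : Pt), ℓ ∈ rad s u x.1 → supNorm (ℓ - (N : ℤ) • u) ≤ R₀ * N)
    (U : Pt → Finset Pt) (W : Finset Pt) {I Γ J : Pt → Pt → ℝ} {H : Pt → Pt → Pt → ℝ} {C_I C_Γ C_Γ' C_H C_J C_J' : ℝ}
    (hI0 : ∀ x' u, |I x' u| ≤ C_I) (hΓ0 : ∀ c x, |Γ c x| ≤ C_Γ)
    (hΓ1 : ∀ c t (i : Fin 4), |Γ c (t + Pi.single i 1) - Γ c t|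
      ≤ C_Γ' / ((supNorm (c - t) : ℝ) + 1) ^ 3 * Real.exp (-(δ / N) * (supNorm (c - t) : ℝ)))
    (hH : ∀ b' x x', |H b' x x'| ≤ C_H * Real.exp (-δH * l1 (x - b')) * Real.exp (-δH * l1 (x' - b')))
    (hH0 : ∀ b' x', ∑' x, H b' x x' = 0) (S V : Finset Pt) (v₀ : Pt)
    (hJ : ∀ b, |J b v₀| ≤ C_J * Real.exp (-(δ / N) * (supNorm (b - (N : ℤ) • v₀) : ℝ)))
    (hJ' : ∀ b', ∑ v ∈ V, (1 + ((supNorm (b' - (N : ℤ) • v) : ℝ) / N) ^ 2) * |J b' v| ≤ C_J') :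
    ∑ v ∈ V, (supNorm (v - v₀) : ℝ) ^ 2 *
        |∑ b ∈ S, ∑ b' ∈ S, J b v₀ * J b' v *
          (∑ u ∈ U b, ∑ w ∈ W, ker₁ (sclW N p) (sclFld N u) (sclBg N u rad) b (b + w) *
            ∑' x', I x' u * ∑' x, Γ (b + w) x * H b' x x')|
      ≤ 3 * C_J * C_J' * (1 + 16 / δ ^ 2) *
        ((C_I * (C_H * Zl 4 δH)) *
          ((256 / 27 * C_Γ' * (Real.exp (δH / 2) * (2 / δH) * Zl 4 (δH / 2)))
              * ((1 + 2 * ((R₀ : ℝ) + 1) ^ 2) * (1 + 80 * Real.exp ((3 * δ / 4) / 2) * (2 / (3 * δ / 4)))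
                + 2 * (1 + 160 * Real.exp ((3 * δ / 4) / 2) * (2 / (3 * δ / 4)) ^ 3)) * N
            + (2 * C_Γ * 20 ^ 8 * (40320 * Real.exp (δH / 2) * (2 / δH) ^ 8 * Zl 4 (δH / 2))
                + (8 * C_Γ * (Real.exp (δH / 2) * (2 / δH) * Zl 4 (δH / 2)) + 2 * C_Γ * (Real.exp (δH / 2) * Zl 4 (δH / 2))) * 5 ^ 8)
              * 81 * (3 + 2 * ((R₀ : ℝ) + 1) ^ 2)) *
          ((((ℓ₀ : ℕ) : ℝ) * ∑ s, p s) * Real.exp (δ * R₀ / 2) *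
            (Real.exp (δ / 2) * (1 + 480 * Real.exp (δ / 4) * (4 / δ) ^ 4)))) := by
  classical
  -- far offsets vanish: filter the offset window at radius `(R₀+1)N`
  have hzW : ∀ u b w, ¬ supNorm w ≤ (R₀ + 1) * N →
      ker₁ (sclW N p) (sclFld N u) (sclBg N u rad) b (b + w) = 0 := by
    intro u b w hfar
    by_contra hne
    have h := scl_ker₁_fld_local (p := p) hradR hne
    rw [add_sub_cancel_left] at h
    exact hfar h
  set W' : Finset Pt := W.filter (fun w => supNorm w ≤ (R₀ + 1) * N) with hW'
  have hWr : ∀ w ∈ W', supNorm w ≤ (R₀ + 1) * N := fun w hw => (Finset.mem_filter.mp hw).2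
  have hker : ∀ u b (b' : Pt), ∑ w ∈ W, ker₁ (sclW N p) (sclFld N u) (sclBg N u rad) b (b + w) * ∑' x', I x' u * ∑' x, Γ (b + w) x * H b' x x'
      = ∑ w ∈ W', ker₁ (sclW N p) (sclFld N u) (sclBg N u rad) b (b + w) * ∑' x', I x' u * ∑' x, Γ (b + w) x * H b' x x' := by
    intro u b b'
    exact legSum_eq_filter (q := fun u b c => ker₁ (sclW N p) (sclFld N u) (sclBg N u rad) b c)
      (fun c => ∑' x', I x' u * ∑' x, Γ c x * H b' x x') (fun w => supNorm w ≤ (R₀ + 1) * N) hzW W u b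
  simp only [hker]
  have h := coarse_mix3_secondMoment_le
    (qd := fun u b c => ker₁ (sclW N p) (sclFld N u) (sclBg N u rad) b c) (U := U) (W := W') (R := R₀ + 1)
    hδ hδH hN hWr hI0 hΓ0 hΓ1 hH hH0 S V v₀ hJ hJ' (windowedMass_scl_le hδ hN hp hrad hradR U W' S ((N : ℤ) • v₀))
  have e : (((R₀ + 1 : ℕ) : ℝ)) = (R₀ : ℝ) + 1 := by push_cast; ring
  rw [e] at h
  exact h

end Scalar

/-! ## §2 The END -/

/-- **THE END `ghost_mix3_rem` — ROW (GH-a) PIECE (g4), THE (MIX-3) GHOST TWIN** ([our object]; `d = 4`): with `C, C′` of `ghostColumn_engineLetters` (the scalar minimiser's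
N-free, a-free letters), for EVERY `a > 0`, `N ≥ 1`, every 0-form rooted block family at blocking `N` (rules `σ`, `p σ ≥ 0`, radial words of length `≤ ℓ₀` within `R₀·N` of the
anchor), every `Γ`, `Ḣ` carrying the engine's DISPLAYED letters (Γ₀)(Γ₁) at rate `δ := deltaH 4 1` and (H)(H0) at any `δ_H > 0`, ANY coarse windows `U b`, all finite `W`, `S`,
`V`, every `v₀` (`𝓘_gh(c,u) := kerH (N−1) a c u`):
`Σ_{v∈V}‖v−v₀‖∞²·|Σ_{b,b′∈S} 𝓘_gh(b,v₀)·𝓘_gh(b′,v)·Σ_{u∈U b}Σ_{w∈W} ker₁^{(u)} b (b+w)·Σ'_{x′} 𝓘_gh(x′,u)·Σ'_x Γ (b+w) x·Ḣ b′ x x′| ≤ 3·C·C′·(1+16∕δ²)·((C·(C_H·Zl 4 δ_H))·Ψ·A_M)`,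
`Ψ` = the engine's cubic-profile factor at `R = R₀+1` (explicit `N¹`), `A_M = (ℓ₀·Σ_σ p σ)·e^{δR₀∕2}·(e^{δ∕2}(1+480e^{δ∕4}(4∕δ)⁴))` — EVERY power of `N` displayed:
`N¹·(ℓ₀·Σp)` × numbers × `C_H`, `C_Γ`, `C_Γ′`.  NOT the identification with the K_n-ghost's (MIX-3) term, NOT the `Γ`∕`Ḣ` instances, NOT `Mix_n = O(1)`, NOT (GH-a), NOT hbook,
NOT D1, NOT BetaPertH. -/
theorem ghost_mix3_rem :
    ∃ C C' : ℝ, 0 ≤ C ∧ 0 ≤ C' ∧ ∀ {a : ℝ}, 0 < a → ∀ (N : ℕ), 1 ≤ N →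
      ∀ {σ : Type*} [Fintype σ] {p : σ → ℝ} (_ : ∀ s, 0 ≤ p s)
        {rad : σ → Pt → Pt → List Pt} {ℓ₀ R₀ : ℕ} (_ : ∀ s u x', (rad s u x').length ≤ ℓ₀)
        (_ : ∀ (s : σ) (u : Pt) (x : ↥(fineBlock N)) (ℓ : Pt), ℓ ∈ rad s u x.1 → supNorm (ℓ - (N : ℤ) • u) ≤ R₀ * N)
        {Γ : Pt → Pt → ℝ} {H : Pt → Pt → Pt → ℝ} {C_Γ C_Γ' C_H δH : ℝ} (_ : 0 < δH)
        (_ : ∀ c x, |Γ c x| ≤ C_Γ)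
        (_ : ∀ c t (i : Fin 4), |Γ c (t + Pi.single i 1) - Γ c t|
          ≤ C_Γ' / ((supNorm (c - t) : ℝ) + 1) ^ 3 * Real.exp (-(deltaH 4 1 / N) * (supNorm (c - t) : ℝ)))
        (_ : ∀ b' x x', |H b' x x'| ≤ C_H * Real.exp (-δH * l1 (x - b')) * Real.exp (-δH * l1 (x' - b')))
        (_ : ∀ b' x', ∑' x, H b' x x' = 0)
        (U : Pt → Finset Pt) (W S V : Finset Pt) (v₀ : Pt),
        ∑ v ∈ V, (supNorm (v - v₀) : ℝ) ^ 2 *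
            |∑ b ∈ S, ∑ b' ∈ S, kerH (N - 1) a b v₀ * kerH (N - 1) a b' v *
              (∑ u ∈ U b, ∑ w ∈ W, ker₁ (sclW N p) (sclFld N u) (sclBg N u rad) b (b + w) *
                ∑' x', kerH (N - 1) a x' u * ∑' x, Γ (b + w) x * H b' x x')|
          ≤ 3 * C * C' * (1 + 16 / deltaH 4 1 ^ 2) *
            ((C * (C_H * Zl 4 δH)) *
              ((256 / 27 * C_Γ' * (Real.exp (δH / 2) * (2 / δH) * Zl 4 (δH / 2)))
                  * ((1 + 2 * ((R₀ : ℝ) + 1) ^ 2) * (1 + 80 * Real.exp ((3 * deltaH 4 1 / 4) / 2) * (2 / (3 * deltaH 4 1 / 4)))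
                    + 2 * (1 + 160 * Real.exp ((3 * deltaH 4 1 / 4) / 2) * (2 / (3 * deltaH 4 1 / 4)) ^ 3)) * N
                + (2 * C_Γ * 20 ^ 8 * (40320 * Real.exp (δH / 2) * (2 / δH) ^ 8 * Zl 4 (δH / 2))
                    + (8 * C_Γ * (Real.exp (δH / 2) * (2 / δH) * Zl 4 (δH / 2)) + 2 * C_Γ * (Real.exp (δH / 2) * Zl 4 (δH / 2))) * 5 ^ 8)
                  * 81 * (3 + 2 * ((R₀ : ℝ) + 1) ^ 2)) *
              ((((ℓ₀ : ℕ) : ℝ) * ∑ s, p s) * Real.exp (deltaH 4 1 * R₀ / 2) *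
                (Real.exp (deltaH 4 1 / 2) * (1 + 480 * Real.exp (deltaH 4 1 / 4) * (4 / deltaH 4 1) ^ 4)))) := by
  obtain ⟨C, C', hC, hC', h⟩ := ghostColumn_engineLetters
  refine ⟨C, C', hC, hC', fun {a} ha N hN σ _ p hp rad ℓ₀ R₀ hrad hradR Γ H C_Γ C_Γ' C_H δH hδH hΓ0 hΓ1 hH hH0 U W S V v₀ => ?_⟩
  have hδ : 0 < deltaH 4 1 := deltaH_pos 4 one_pos
  obtain ⟨hI, hJ'⟩ := h ha N hN
  have hI0 : ∀ c u : Pt, |kerH (N - 1) a c u| ≤ C := by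
    intro c u
    refine (hI c u).trans ?_
    have h1 : Real.exp (-(deltaH 4 1 / N) * (supNorm (c - (N : ℤ) • u) : ℝ)) ≤ 1 := by
      apply Real.exp_le_one_iff.mpr
      have : (0 : ℝ) ≤ deltaH 4 1 / N := by positivity
      have : (0 : ℝ) ≤ (supNorm (c - (N : ℤ) • u) : ℝ) := Nat.cast_nonneg _
      nlinarith
    calc C * Real.exp (-(deltaH 4 1 / N) * (supNorm (c - (N : ℤ) • u) : ℝ)) ≤ C * 1 := mul_le_mul_of_nonneg_left h1 hC
      _ = C := mul_one C
  exact coarse_mix3_secondMoment_scl (N := N) hδ hδH hN hp hrad hradR U W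
    (I := fun c u => kerH (N - 1) a c u) (J := fun b v => kerH (N - 1) a b v)
    hI0 hΓ0 hΓ1 hH hH0 S V v₀ (fun b => hI b v₀) (fun b' => hJ' b' V)

end Summit.QuantumFields.BalabanUV.Beta.FP.GhostLoopCountingMixCubic

end
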